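import Summits.QuantumFields.YangMills.Theorems.UnitScaleTiltProp7EngOfTrueAvgBudget
import Summits.QuantumFields.YangMills.Theorems.UnitScaleTiltProp7QTwOneH1Row
import Summits.QuantumFields.YangMills.Theorems.UnitScaleTiltProp7CovIterLambdaHLambdaBridge
import HarnessLib

/-!
# Route `UnitScaleTilt`, crux K1 «MinimiserStabilityRegPr» (stmt-QuantumFields-19200), LANE II (QH1)♮ — THE CENTRAL ROW `hcen` AT THE FLAT BACKGROUND,
# IN THE HILBERT LETTERS OF ✓`Prop7QH1OfSectors.hQH1_of_sectors` AND FOR THE DOOR'S FUNCTIONAL `H f := c₀L·ℓ²·CURL_HS f + ‖D*_W f‖²`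

Cell `ym3-torus`, width seat `ym3-torus-px22` (gen 6).  THEOREMS ONLY (0 `def`, 0 `sorry`); `--supports stmt-QuantumFields-19200 --as helper`, count-neutral.
YM₃ on T³ is a ladder rung (R3) — NOT d = 4, NOT infinite volume, NOT a mass gap, NOT the Clay problem; nothing here claims a stub, the crux or the gap.

THE POINT.  ★px21 g8's door ✓p718170 `hQH1_of_sectors` displays the central-sector row `hcen` of the (QH1)♮ hypothesis `hQH1` (member `W`, central field `τ•1`,
functional `H`).  ★px10 g5's transfer `hcen_of_flat` (✓`QTw_smul_one_eq_QTw_one_of_regPr`) reduces it to the SAME ROW AT THE FLAT BACKGROUND `W = 1`.  This file proves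
that flat row for the door's letter `H` (★px21's FILE 2 lambda written out at `W := 1`): the flat (QH1)♮ row ✓p718117 `Prop7QTwOneH1Row.QTw_one_H1_row` read through the
slot dictionaries of ✓p706335 (`aQ_normSq_Qkc_toL2_eq`, `norm_toL2_sq`, Frobenius ≤ 2·operator, `norm_sq_DstarL2_toL2_eq`) and ★routeR-w2's operator-norm Weitzenböck
✓`sum_normSq_covGrad_le_curl_divB` at `U₀ := 1` (gradient energy ≤ CURL_HS ⊕ DIV_HS ⊕ `12·e·ℓ⁻²`·mass).

* ★★★ `hcen_one (c₀ cB)` — `∀ L > 1 ∃ B B′ B″ eQ (= 6, 6C₂(L), 72C₂(L), 1), ∀ F (F.L = L) n K (n < K) e, 0 < e → e ≤ eQ → RegPr F n K e 1 → ∀ τ,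
  (c₀∕cB)·ℓ³·‖Qkc … 1 (toL2 (τ•1))‖² ≤ B‖toL2 (τ•1)‖² + B′·H_door F n K 1 (toL2 (τ•1)) + B″·e·‖toL2 (τ•1)‖²`.

HONEST SCOPE.  Flat background only; a by-name knit; nothing of `hcen` at a curved `W` (★px10's transfer), `h𝔰𝔲`, `hQH1`, (REC), `hN06`, EX or the crux is proved here.

References: T. Bałaban, CMP 99 (1985) 389–434 [Balaban1985BackgroundPropagators] ((3.10)–(3.11) p.392, (3.14) p.393); CMP 102 (1985) 277–309 [Balaban1985Variational] ((44)–(45) p.285);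
CMP 95 (1984) 17–40 [Balaban1984PropagatorsI] ((1.18)–(1.21) pp.20–21).
-/

noncomputable section

open scoped BigOperators Matrix.Norms.L2Operator Matrix InnerProductSpace ComplexConjugate

namespace Summit.QuantumFields.YangMills.Theorems.Prop7QH1CentralRowFlat

open Literature.MathematicalPhysics.QuantumFieldTheory.Balaban1983to89
open Literature.MathematicalPhysics.QuantumFieldTheory.Balaban1983to89.T3ContinuumYM3Torus
open Literature.MathematicalPhysics.QuantumFieldTheory.Balaban1983to89.T3PrintedRegularMinimiser (RegPr)
open Finset T4Continuum BlockAveraging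
open B9Eq39Adjoint (curl divB)
open B10Eq27TorusAxialLog (unitsField toUField)
open B9TorusCalculus (torusT)
open B11Eq103H1Complex (BondL2K)
open Summit.QuantumFields.YangMills.Theorems.Prop7SectET3Transport (periodsT3)
open Summit.QuantumFields.YangMills.Theorems.Prop7SectET3HilbertLetters (W₂ frobEquiv toL2 DstarL2)
open Summit.QuantumFields.YangMills.Theorems.Prop7SectET3CombLetters (Qkc)
open Summit.QuantumFields.YangMills.Theorems.Prop7SymAvgTw (QTw)
open Summit.QuantumFields.YangMills.Theorems.Prop7DeltaEtaAlmostPositive (norm_toL2_sq)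
open Summit.QuantumFields.YangMills.Theorems.Prop7DivSliceOfMemberDivSq (norm_sq_DstarL2_toL2_eq)
open Summit.QuantumFields.YangMills.Theorems.Prop7TwistedLevelMassOfRegPr (plaq_le_of_regPr)
open Summit.QuantumFields.YangMills.Theorems.Prop7EngOfTrueAvgBudget (aQ_normSq_Qkc_toL2_eq sum_normSq_le_sum_frob sum_frob_le_two_mul_sum_normSq)
open Summit.QuantumFields.YangMills.Theorems.Prop7CovIterLambdaHLambdaBridge (sum_normSq_covGrad_le_curl_divB)
open Summit.QuantumFields.YangMills.Theorems.Prop7QTwOneH1Row (QTw_one_H1_row)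
open Summit.QuantumFields.YangMills.Theorems.Prop7CentreStairLegsFlat (energy_eq_sum_bond)

set_option maxHeartbeats 400000 in
-- HEARTBEAT rule (README∕RULING №24 (a)): the statement carries ★px21's door lambda `H` written out (two five-fold sums) plus the Hilbert slot letters; elaboration + the knit measured > 100k; decl-local ≤ 400k.
/-- ★★★ **`hcen` AT THE FLAT BACKGROUND, FOR THE DOOR'S `H`.**  See the module docstring: ✓p718170's displayed central row with `W := 1`, the functional being ★px21's
`H f := c₀L·ℓ²·CURL_HS f + ‖D*_W f‖²` (written out), constants `B = 6`, `B′ = 6·C₂(L)`, `B″ = 72·C₂(L)` (`C₂` of ✓`QTw_one_H1_row`), `eQ = 1`.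
[cite: Balaban1985BackgroundPropagators, (3.10)-(3.11) p.392, (3.14) p.393; Balaban1985Variational, (44)-(45) p.285; Balaban1984PropagatorsI, (1.21) p.21] -/
theorem hcen_one (c₀ cB : ℕ → ℝ) [hc₀ : ∀ L : ℕ, Fact (0 < c₀ L)] [hcB : ∀ L : ℕ, Fact (0 < cB L)] :
    ∀ (L : ℕ), 1 < L → ∃ B B' B'' eQ : ℝ, 0 ≤ B ∧ 0 ≤ B' ∧ 0 ≤ B'' ∧ 0 < eQ ∧
      ∀ (F : T3Family), F.L = L → ∀ (n K : ℕ) (hnK : n < K) (e : ℝ),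
        0 < e → e ≤ eQ → RegPr F n K e (1 : GaugeField (F.P K) 0 (Matrix.specialUnitaryGroup (Fin 2) ℂ)) →
        ∀ τ : PBond (F.P K) 0 → ℂ,
          (c₀ F.L / cB F.L) * ((F.L : ℝ) ^ (K - n)) ^ 3
              * ‖Qkc F n K hnK.le (c₀ F.L) (cB F.L) (1 : GaugeField (F.P K) 0 (Matrix.specialUnitaryGroup (Fin 2) ℂ))
                  (toL2 F K (c₀ F.L) (fun b => τ b • (1 : Matrix (Fin 2) (Fin 2) ℂ)))‖ ^ 2
            ≤ B * ‖toL2 F K (c₀ F.L) (fun b => τ b • (1 : Matrix (Fin 2) (Fin 2) ℂ))‖ ^ 2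
              + B' * ((fun (F : T3Family) (n K : ℕ) (W : GaugeField (F.P K) 0 (Matrix.specialUnitaryGroup (Fin 2) ℂ))
                    (f : BondL2K ℂ 3 (periodsT3 F K) (c₀ F.L) W₂) =>
                  c₀ F.L * ((F.L : ℝ) ^ (K - n)) ^ 2 * (∑ x : Site (F.P K) 0, ∑ μ : Fin (F.P K).d, ∑ ν : Fin (F.P K).d,
                      (if μ < ν then ∑ j : Fin 2, ∑ k : Fin 2,
                        ‖(curl (torusT (F.P K) 0) (fun κ z => unitsField (toUField W) ⟨z, κ⟩) (fun κ z => (toL2 F K (c₀ F.L)).symm f ⟨z, κ⟩) μ ν x) j k‖ ^ 2 else 0))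
                    + ‖DstarL2 F n K (c₀ F.L) W f‖ ^ 2)
                  F n K (1 : GaugeField (F.P K) 0 (Matrix.specialUnitaryGroup (Fin 2) ℂ)) (toL2 F K (c₀ F.L) (fun b => τ b • (1 : Matrix (Fin 2) (Fin 2) ℂ))))
              + B'' * e * ‖toL2 F K (c₀ F.L) (fun b => τ b • (1 : Matrix (Fin 2) (Fin 2) ℂ))‖ ^ 2 := by
  intro L hL
  obtain ⟨C₁, C₂, hC₁, hC₂, hrow⟩ := QTw_one_H1_row L hL
  refine ⟨2 * C₁, 2 * C₂, 24 * C₂, 1, by positivity, by positivity, by positivity, one_pos, ?_⟩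
  intro F hFL n K hnK e he he1 hreg τ
  have hc : 0 < c₀ F.L := (hc₀ F.L).out
  have hL0 : (0 : ℝ) < F.L := by have := F.hL.2; rw [← hFL] at hL; positivity
  -- beta-reduce the door functional and cancel `toL2⁻¹ ∘ toL2`
  beta_reduce
  rw [LinearEquiv.symm_apply_apply]
  set X : PBond (F.P K) 0 → Matrix (Fin 2) (Fin 2) ℂ := fun b => τ b • (1 : Matrix (Fin 2) (Fin 2) ℂ) with hX
  have hℓ0 : (0 : ℝ) < (F.L : ℝ) ^ (K - n) := pow_pos hL0 _
  -- (1) the AVG dictionary at `a₀ := 1`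
  have havg := aQ_normSq_Qkc_toL2_eq (F := F) hnK.le (c₀ := c₀ F.L) (cB := cB F.L) 1 (1 : GaugeField (F.P K) 0 (Matrix.specialUnitaryGroup (Fin 2) ℂ)) X
  rw [one_mul, one_mul] at havg
  -- (2) Frobenius ≤ 2·operator and the flat (QH1)♮ row
  have hFQ := sum_frob_le_two_mul_sum_normSq (F := F) (K := n) (fun c => QTw F n K hnK.le 1 X c)
  have hflat := hrow F hFL n K hnK X
  -- (3) the flat Weitzenböck
  have hU : ∀ p : Plaq (F.P K) 0, dist1 (GaugeField.plaqHol (1 : GaugeField (F.P K) 0 (Matrix.specialUnitaryGroup (Fin 2) ℂ)) p) ≤ e * ((((F.L : ℝ) ^ (K - n))) ^ 2)⁻¹ :=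
    plaq_le_of_regPr F n K hreg
  have ha0 : 0 ≤ e * ((((F.L : ℝ) ^ (K - n))) ^ 2)⁻¹ := by positivity
  have hW := sum_normSq_covGrad_le_curl_divB (1 : GaugeField (F.P K) 0 (Matrix.specialUnitaryGroup (Fin 2) ℂ)) ha0 hU X
  have h1 : ∀ (b : PBond (F.P K) 0) (ν : Fin (F.P K).d),
      (((1 : GaugeField (F.P K) 0 (Matrix.specialUnitaryGroup (Fin 2) ℂ)) ⟨b.src, ν⟩ : Matrix.specialUnitaryGroup (Fin 2) ℂ) : Matrix (Fin 2) (Fin 2) ℂ)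
          * X ⟨b.src.shift ν, b.dir⟩
          * star (((1 : GaugeField (F.P K) 0 (Matrix.specialUnitaryGroup (Fin 2) ℂ)) ⟨b.src, ν⟩ : Matrix.specialUnitaryGroup (Fin 2) ℂ) : Matrix (Fin 2) (Fin 2) ℂ)
        = X ⟨b.src.shift ν, b.dir⟩ := by
    intro b ν
    have e1 : (((1 : GaugeField (F.P K) 0 (Matrix.specialUnitaryGroup (Fin 2) ℂ)) ⟨b.src, ν⟩ : Matrix.specialUnitaryGroup (Fin 2) ℂ) : Matrix (Fin 2) (Fin 2) ℂ) = 1 := rfl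
    rw [e1, star_one, one_mul, mul_one]
  have hGeq : ∑ b : PBond (F.P K) 0, ∑ ν : Fin (F.P K).d,
      ‖(((1 : GaugeField (F.P K) 0 (Matrix.specialUnitaryGroup (Fin 2) ℂ)) ⟨b.src, ν⟩ : Matrix.specialUnitaryGroup (Fin 2) ℂ) : Matrix (Fin 2) (Fin 2) ℂ)
          * X ⟨b.src.shift ν, b.dir⟩
          * star (((1 : GaugeField (F.P K) 0 (Matrix.specialUnitaryGroup (Fin 2) ℂ)) ⟨b.src, ν⟩ : Matrix.specialUnitaryGroup (Fin 2) ℂ) : Matrix (Fin 2) (Fin 2) ℂ)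
        - X b‖ ^ 2
      = ∑ x : Site (F.P K) 0, ∑ κ : Fin 3, ∑ ν : Fin 3, ‖X ⟨x.shift ν, κ⟩ - X ⟨x, κ⟩‖ ^ 2 := by
    rw [Finset.sum_congr rfl (fun b _ => Finset.sum_congr rfl (fun ν _ => by rw [h1 b ν])), ← energy_eq_sum_bond]
    calc ∑ μ : Fin (F.P K).d, ∑ ν : Fin (F.P K).d, ∑ x : Site (F.P K) 0, ‖X ⟨x.shift ν, μ⟩ - X ⟨x, μ⟩‖ ^ 2
        = ∑ μ : Fin (F.P K).d, ∑ x : Site (F.P K) 0, ∑ ν : Fin (F.P K).d, ‖X ⟨x.shift ν, μ⟩ - X ⟨x, μ⟩‖ ^ 2 :=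
          Finset.sum_congr rfl fun μ _ => Finset.sum_comm
      _ = ∑ x : Site (F.P K) 0, ∑ μ : Fin (F.P K).d, ∑ ν : Fin (F.P K).d, ‖X ⟨x.shift ν, μ⟩ - X ⟨x, μ⟩‖ ^ 2 := Finset.sum_comm
  rw [hGeq] at hW
  have hd : ((F.P K).d : ℝ) = 3 := by norm_num [T3ContinuumYM3Torus.T3Family.P_d]
  have hN : ((2 : ℕ) : ℝ) = 2 := by norm_num
  rw [hd, hN] at hW
  -- (4) dictionaries
  have hdiv := norm_sq_DstarL2_toL2_eq F n K (c₀ F.L) (1 : GaugeField (F.P K) 0 (Matrix.specialUnitaryGroup (Fin 2) ℂ)) X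
  have hy : ‖toL2 F K (c₀ F.L) X‖ ^ 2 = c₀ F.L * ∑ b : PBond (F.P K) 0, ‖(frobEquiv.symm (X b) : W₂)‖ ^ 2 := norm_toL2_sq X
  have hS_le := sum_normSq_le_sum_frob X
  -- abbreviations (now, so that every hypothesis above is folded)
  set ℓ : ℝ := (F.L : ℝ) ^ (K - n) with hℓ
  set CURL := (∑ x : Site (F.P K) 0, ∑ μ : Fin (F.P K).d, ∑ ν : Fin (F.P K).d,
      (if μ < ν then ∑ j : Fin 2, ∑ k : Fin 2,
        ‖(curl (torusT (F.P K) 0) (fun κ z => unitsField (toUField (1 : GaugeField (F.P K) 0 (Matrix.specialUnitaryGroup (Fin 2) ℂ))) ⟨z, κ⟩)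
            (fun κ z => X ⟨z, κ⟩) μ ν x) j k‖ ^ 2 else 0)) with hCURL
  set DIV := (∑ x : Site (F.P K) 0, ∑ j : Fin 2, ∑ k : Fin 2,
      ‖(divB (torusT (F.P K) 0) (fun κ z => unitsField (toUField (1 : GaugeField (F.P K) 0 (Matrix.specialUnitaryGroup (Fin 2) ℂ))) ⟨z, κ⟩)
          (fun κ z => X ⟨z, κ⟩) x) j k‖ ^ 2) with hDIV
  set S := ∑ b : PBond (F.P K) 0, ‖X b‖ ^ 2 with hS
  set SF := ∑ b : PBond (F.P K) 0, ‖(frobEquiv.symm (X b) : W₂)‖ ^ 2 with hSF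
  set FQ := ∑ c : PBond (F.P n) 0, ‖(frobEquiv.symm (QTw F n K hnK.le (1 : GaugeField (F.P K) 0 (Matrix.specialUnitaryGroup (Fin 2) ℂ)) X c) : W₂)‖ ^ 2 with hFQ
  set SQ := ∑ c : PBond (F.P n) 0, ‖QTw F n K hnK.le (1 : GaugeField (F.P K) 0 (Matrix.specialUnitaryGroup (Fin 2) ℂ)) X c‖ ^ 2 with hSQ
  set G := ∑ x : Site (F.P K) 0, ∑ κ : Fin 3, ∑ ν : Fin 3, ‖X ⟨x.shift ν, κ⟩ - X ⟨x, κ⟩‖ ^ 2 with hG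
  set DD := ‖DstarL2 F n K (c₀ F.L) 1 (toL2 F K (c₀ F.L) X)‖ ^ 2 with hDD
  set YY := ‖toL2 F K (c₀ F.L) X‖ ^ 2 with hYY
  set QQ := ‖Qkc F n K hnK.le (c₀ F.L) (cB F.L) 1 (toL2 F K (c₀ F.L) X)‖ ^ 2 with hQQ
  have hS0 : 0 ≤ S := Finset.sum_nonneg fun _ _ => sq_nonneg _
  have hCURL0 : 0 ≤ CURL := by
    refine Finset.sum_nonneg fun _ _ => Finset.sum_nonneg fun _ _ => Finset.sum_nonneg fun _ _ => ?_
    split_ifs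
    · exact Finset.sum_nonneg fun _ _ => Finset.sum_nonneg fun _ _ => sq_nonneg _
    · exact le_rfl
  have hG0 : 0 ≤ G := Finset.sum_nonneg fun _ _ => Finset.sum_nonneg fun _ _ => Finset.sum_nonneg fun _ _ => sq_nonneg _
  have hSy : c₀ F.L * S ≤ YY := by rw [hy]; exact mul_le_mul_of_nonneg_left hS_le hc.le
  have hYY0 : 0 ≤ YY := by positivity
  -- (5) assembly
  -- havg : (c₀/cB)·ℓ³·QQ = c₀·ℓ·FQ ; hFQ : FQ ≤ 2 SQ ; hflat : ℓ SQ ≤ C₁ S + C₂ ℓ² G ; hW : G ≤ CURL + DIV + 2·3·(e ℓ⁻²)·(2 S) ; hdiv : DD = c₀ ℓ² DIV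
  have hℓℓ : ℓ ^ 2 * (ℓ ^ 2)⁻¹ = 1 := by field_simp
  have step1 : c₀ F.L * ℓ * FQ ≤ 2 * C₁ * (c₀ F.L * S) + 2 * C₂ * (c₀ F.L * ℓ ^ 2 * G) := by
    have h1 : c₀ F.L * ℓ * FQ ≤ c₀ F.L * ℓ * (2 * SQ) := mul_le_mul_of_nonneg_left hFQ (by positivity)
    have h2 : c₀ F.L * (ℓ * SQ) ≤ c₀ F.L * (C₁ * S + C₂ * ℓ ^ 2 * G) := mul_le_mul_of_nonneg_left hflat hc.le
    nlinarith [h1, h2]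
  have step2 : c₀ F.L * ℓ ^ 2 * G ≤ (c₀ F.L * ℓ ^ 2 * CURL + DD) + 12 * e * (c₀ F.L * S) := by
    have h := mul_le_mul_of_nonneg_left hW (by positivity : (0 : ℝ) ≤ c₀ F.L * ℓ ^ 2)
    have e2 : c₀ F.L * ℓ ^ 2 * (CURL + DIV + 2 * 3 * (e * (ℓ ^ 2)⁻¹) * (2 * S))
        = (c₀ F.L * ℓ ^ 2 * CURL + c₀ F.L * ℓ ^ 2 * DIV) + 12 * e * (c₀ F.L * S) * (ℓ ^ 2 * (ℓ ^ 2)⁻¹) := by ring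
    rw [e2, hℓℓ, mul_one, ← hdiv] at h
    exact h
  calc (c₀ F.L / cB F.L) * ℓ ^ 3 * QQ = c₀ F.L * ℓ * FQ := havg
    _ ≤ 2 * C₁ * (c₀ F.L * S) + 2 * C₂ * (c₀ F.L * ℓ ^ 2 * G) := step1
    _ ≤ 2 * C₁ * YY + 2 * C₂ * ((c₀ F.L * ℓ ^ 2 * CURL + DD) + 12 * e * (c₀ F.L * S)) := by
        have h1 := mul_le_mul_of_nonneg_left hSy (by positivity : (0 : ℝ) ≤ 2 * C₁)
        have h2 := mul_le_mul_of_nonneg_left step2 (by positivity : (0 : ℝ) ≤ 2 * C₂)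
        linarith
    _ ≤ 2 * C₁ * YY + 2 * C₂ * (c₀ F.L * ℓ ^ 2 * CURL + DD) + 24 * C₂ * e * YY := by
        have h3 : 12 * e * (c₀ F.L * S) ≤ 12 * e * YY := mul_le_mul_of_nonneg_left hSy (by positivity)
        have h4 := mul_le_mul_of_nonneg_left h3 (by positivity : (0 : ℝ) ≤ 2 * C₂)
        nlinarith [h4]

end Summit.QuantumFields.YangMills.Theorems.Prop7QH1CentralRowFlat

end
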